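import Summits.ResolutionOfSingularities.ResolutionOfSingularities.Theorems.MarkedTransferCampaignW46PrincipalRidgeHasse
import HarnessLib

/-!
# [OURS · L1 W4.6, rung (iv) «large characteristic»] In tame degree the ridge IDEAL of a hypersurface cone is generated
# by LINEAR forms — the linear Hasse coefficients `D^{(A)} h`, `|A| = d − 1` — i.e. `Rid = Dir` as subschemes; this is
# Berthomieu–Hivert–Mourtada's Lemma 3.6 (tree named fact `PrincipalRidgeIdealEqSpanHassePPow`) in the range `d < p`
# (cell res-hironaka, LADDER-RESOLUTION rung L, D-0089; slot W4.6, seat res-L1-s46-pv-7; host route MarkedTransfer,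
# `--supports stmt-ResolutionOfSingularities-16155 --as helper`)

HONEST FRAMING. Nothing here is a statement of H. Hironaka's manuscript (2017-03-23, [Hironaka2017]) and nothing here
asserts that any statement of it holds. Self-contained commutative algebra over the TREE (`ridge`, `ridgeIdeal`,
`mem_ridge_iff_forall_ridgeIdeal`, `hasseDeriv`, `hasseCoefficientsPPow`, the named fact
`PrincipalRidgeIdealEqSpanHassePPow`) and this seat's `TameRidgeFunctor` (p485759: tame ridge = polar kernel on every
commutative `K`-algebra) and `PrincipalRidgeHasse` (p486399: `coeff_β(D_v^{(d−|β|)} H) = (D^{(β)} H)(v)`, Yoneda for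
ideals, BHM Cor. 2.3). No premise of the manuscript, no FACT-LIST premise. AI review is weaker than expert review.
No `sorry`, no definition; axioms standard.

## What is proved

* `eval_hasseDeriv_eq_coeff_polar` — for a form `H` of degree `d` and `|A| + 1 = d`: the value `(D^{(A)} H)(v)` of a
  LINEAR Hasse coefficient is the `A`-th coefficient of the polar `Σ_i v_i ∂_i H`.
* `forall_eval_linearHasse_iff_polar_eq_zero` — hence `v` is a common zero of the linear Hasse coefficients iff
  `∂_v H = 0` (the polar is a form of degree `d − 1`, so these coefficients are all of it).
* `ridgeIdeal_span_singleton_eq_span_linearHasse` — **TAME DEGREE: THE RIDGE IDEAL IS LINEAR.** For a form `h` of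
  degree `d` over `K` with `1, …, d` non-zero in `K` (characteristic `0` or `p > d`):
  `𝔉((h)) = ⟨D^{(A)} h : |A| + 1 = d⟩`, an ideal generated by linear forms (`isHomogeneous_one_of_mem_linearHasse`) —
  scheme-theoretically the ridge of the cone `h = 0` IS a linear subspace (its directrix); by `TameRidgeFunctor` its
  points are the polar kernel `𝕎({h})`. Proof: both ideals cut out the same functor of points on all `K`-algebras
  (tame ridge theorem + the first bullet), then Yoneda (`PrincipalRidgeHasse.le_of_forall_aeval_eq_zero`).
* `hasseCoefficientsPPow_eq_linearHasse_of_lt` — for `d < p` the Hasse coefficients of `p`-power degree are exactly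
  the linear ones (`p^j ≤ d < p` forces `j = 0`).
* `principalRidgeIdealEqSpanHassePPow_of_lt_char` — **BHM Lemma 3.6 (principal case) in the tame range**: in
  characteristic `p`, for every form `h` of degree `d < p`, `𝔉((h)) = ⟨𝓔_p(h)⟩`. (The named fact
  `PrincipalRidgeIdealEqSpanHassePPow K n p` quantifies over all degrees; for `d ≥ p` it needs Giraud's structure
  theorem `RidgeIdealSpanAdditive`, not proved in the tree — so this is a PARTIAL discharge, stated as such.)

So in regime (iv) (`p > b`), at the level of IDEALS: ridge = directrix for every hypersurface tangent cone; the honest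
constant is again `C = b ≤ d`, independent of the dimension.

## References (context; nothing is cited as a premise)

* Berthomieu–Hivert–Mourtada 2010, Cor. 2.3, Lemma 3.6, Algorithm 3.5, Rem. 3.12.
  [cite: BerthomieuHivertMourtada2010, Cor. 2.3, Lemma 3.6, Algorithm 3.5]
* Giraud 1975 §1.5; Schober 2021 Rem. 2.6 («char 0: Dir = Rid»). [cite: Giraud1975, §1.5]
  [cite: Schober2021IdealisticExponents, Rem. 2.6]
-/

noncomputable section

set_option linter.dupNamespace false -- mandated namespace of this single-conjunct summit

namespace Summit.ResolutionOfSingularities.ResolutionOfSingularities.Theorems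
namespace CampaignW46
namespace TameRidgeIdeal

open MvPolynomial
open Literature.RingTheory.MvPolynomial
open Literature.AlgebraicGeometry.Resolution
open Literature.AlgebraicGeometry.Resolution.WeightedBlowup.HasseDir

universe u v

/-! ## Linear Hasse coefficients are the coefficients of the polar -/

section Linear

variable {n : ℕ} {S : Type*} [CommRing S]

/-- For a form `H` of degree `d` and `|A| + 1 = d`: `(D^{(A)} H)(v) = coeff_A (Σ_i v_i ∂_i H)`. [folklore] -/
theorem eval_hasseDeriv_eq_coeff_polar {H : MvPolynomial (Fin n) S} {d : ℕ} (hH : H.IsHomogeneous d) (v : Fin n → S)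
    {A : Fin n →₀ ℕ} (hA : A.degree + 1 = d) :
    eval v (hasseDeriv S A H) = coeff A (∑ i, C (v i) * pderiv i H) := by
  classical
  rw [← PrincipalRidgeHasse.coeff_hasseD_eq_eval_hasseDeriv hH v A, TameRidge.polar_eq_hasseD_one,
    show d - A.degree = 1 by omega]

/-- For a form `H` of degree `d`: `v` is a common zero of the LINEAR Hasse coefficients `D^{(A)} H`, `|A| + 1 = d`, iff the
polar `Σ_i v_i ∂_i H` vanishes (the polar is a form of degree `d − 1`). [folklore] -/
theorem forall_eval_linearHasse_iff_polar_eq_zero {H : MvPolynomial (Fin n) S} {d : ℕ} (hH : H.IsHomogeneous d)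
    (v : Fin n → S) :
    (∀ A : Fin n →₀ ℕ, A.degree + 1 = d → eval v (hasseDeriv S A H) = 0) ↔ ∑ i, C (v i) * pderiv i H = 0 := by
  classical
  have hpol : (∑ i, C (v i) * pderiv i H).IsHomogeneous (d - 1) := by
    rw [TameRidge.polar_eq_hasseD_one]
    exact TameRidgeFunctor.isHomogeneous_hasseD hH v 1
  constructor
  · intro h
    ext A
    rw [coeff_zero]
    by_cases hA : A.degree + 1 = d
    · rw [← eval_hasseDeriv_eq_coeff_polar hH v hA, h A hA]
    · rcases Nat.eq_zero_or_pos d with hd | hd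
      · -- `d = 0`: `H` is a constant and its polar vanishes
        subst hd
        have hH0 : H = C (coeff 0 H) := totalDegree_eq_zero_iff_eq_C.mp (Nat.le_zero.mp hH.totalDegree_le)
        have hc : ∀ i, pderiv i H = 0 := fun i => by rw [hH0, pderiv_C]
        simp [hc]
      · exact hpol.coeff_eq_zero (by omega)
  · intro h A hA
    rw [eval_hasseDeriv_eq_coeff_polar hH v hA, h, coeff_zero]

/-- The linear Hasse coefficients ARE linear forms. [folklore] -/
theorem isHomogeneous_one_of_mem_linearHasse {K : Type u} [Field K] {h : MvPolynomial (Fin n) K} {d : ℕ}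
    (hh : h.IsHomogeneous d) {g : MvPolynomial (Fin n) K}
    (hg : g ∈ {g | ∃ A : Fin n →₀ ℕ, A.degree + 1 = d ∧ g = hasseDeriv K A h}) : g.IsHomogeneous 1 := by
  classical
  obtain ⟨A, hA, rfl⟩ := hg
  have := TameRidgeFunctor.isHomogeneous_hasseDeriv hh A
  rwa [show d - A.degree = 1 by omega] at this

end Linear

/-! ## Tame degree: the ridge ideal is generated by the linear Hasse coefficients -/

section Ideal

variable {K : Type u} [Field K] {n : ℕ}

/-- [OURS · L1 W4.6 (iv); NOT a statement of the manuscript] **Tame degree: the ridge ideal is linear.** For a form `h`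
of degree `d` over `K` with `1, …, d` non-zero in `K` (characteristic `0`, or `p > d`):
`𝔉((h)) = ⟨D^{(A)} h : |A| + 1 = d⟩` — Giraud's ridge of the cone `h = 0` is, AS A SUBSCHEME of the tangent space, the
linear subspace cut out by the linear Hasse coefficients (its points are the polar kernel = Hironaka's `𝕎({h})`):
`Rid = Dir` scheme-theoretically in regime (iv). [folklore] -/
theorem ridgeIdeal_span_singleton_eq_span_linearHasse {h : MvPolynomial (Fin n) K} {d : ℕ} (hh : h.IsHomogeneous d)
    (hchar : ∀ m : ℕ, 1 ≤ m → m ≤ d → (m : K) ≠ 0) :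
    ridgeIdeal (Ideal.span {h}) =
      Ideal.span {g | ∃ A : Fin n →₀ ℕ, A.degree + 1 = d ∧ g = hasseDeriv K A h} := by
  classical
  -- both sides have the same points in every commutative `K`-algebra: the polar kernel
  have key : ∀ (k' : Type u) [CommRing k'] [Algebra K k'] (v : Fin n → k'),
      v ∈ ridge k' (Ideal.span {h}) ↔
        ∀ g ∈ {g | ∃ A : Fin n →₀ ℕ, A.degree + 1 = d ∧ g = hasseDeriv K A h}, aeval v g = 0 := by
    intro k' _ _ v
    rw [TameRidgeFunctor.mem_ridge_span_singleton_iff_polar_eq_zero hh hchar,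
      ← forall_eval_linearHasse_iff_polar_eq_zero (hh.map (algebraMap K k')) v]
    constructor
    · rintro H g ⟨A, hA, rfl⟩
      rw [PrincipalRidgeHasse.aeval_hasseDeriv]
      exact H A hA
    · intro H A hA
      rw [← PrincipalRidgeHasse.aeval_hasseDeriv]
      exact H _ ⟨A, hA, rfl⟩
  apply le_antisymm
  · refine PrincipalRidgeHasse.le_of_forall_aeval_eq_zero fun k' _ _ v hv => ?_
    have hmem : v ∈ ridge k' (Ideal.span {h}) := (key k' v).mpr fun g hg => hv g (Ideal.subset_span hg)
    exact mem_ridge_iff_forall_ridgeIdeal.mp hmem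
  · refine PrincipalRidgeHasse.le_of_forall_aeval_eq_zero fun k' _ _ v hv => ?_
    have hlin := (key k' v).mp (mem_ridge_iff_forall_ridgeIdeal.mpr hv)
    have hle : Ideal.span {g | ∃ A : Fin n →₀ ℕ, A.degree + 1 = d ∧ g = hasseDeriv K A h} ≤
        RingHom.ker ((aeval v).toRingHom) :=
      Ideal.span_le.mpr fun g hg => hlin g hg
    intro g hg
    exact hle hg

/-- [OURS · L1 W4.6 (iv)] **Characteristic `p > d`**: `𝔉((h)) = ⟨D^{(A)} h : |A| + 1 = d⟩`. [folklore] -/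
theorem ridgeIdeal_span_singleton_eq_span_linearHasse_of_lt_char (p : ℕ) [CharP K p] {h : MvPolynomial (Fin n) K}
    {d : ℕ} (hh : h.IsHomogeneous d) (hd : d < p) :
    ridgeIdeal (Ideal.span {h}) =
      Ideal.span {g | ∃ A : Fin n →₀ ℕ, A.degree + 1 = d ∧ g = hasseDeriv K A h} :=
  ridgeIdeal_span_singleton_eq_span_linearHasse hh (TamePolar.natCast_ne_zero_of_lt_char p hd)

/-! ## BHM Lemma 3.6 in the tame range -/

/-- For `d < p` (and `p ≥ 1`) the Hasse coefficients of `p`-power degree are exactly the linear ones: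
`𝓔_p(h) = {D^{(A)} h : |A| + 1 = d}`. [folklore] -/
theorem hasseCoefficientsPPow_eq_linearHasse_of_lt {p d : ℕ} (hp : 1 ≤ p) (hd : d < p) (h : MvPolynomial (Fin n) K) :
    hasseCoefficientsPPow p d h = {g | ∃ A : Fin n →₀ ℕ, A.degree + 1 = d ∧ g = hasseDeriv K A h} := by
  ext g
  constructor
  · rintro ⟨A, hA, ⟨j, hj⟩, rfl⟩
    refine ⟨A, ?_, rfl⟩
    rcases Nat.eq_zero_or_pos j with rfl | hjpos
    · rw [pow_zero] at hj
      omega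
    · exfalso
      have : p ≤ p ^ j := by
        calc p = p ^ 1 := (pow_one p).symm
          _ ≤ p ^ j := Nat.pow_le_pow_right hp hjpos
      omega
  · rintro ⟨A, hA, rfl⟩
    exact ⟨A, by omega, ⟨0, by rw [pow_zero]; omega⟩, rfl⟩

/-- [OURS · L1 W4.6 (iv); NOT a statement of the manuscript] **BHM Lemma 3.6 (principal case) in the tame range
`d < p`**: in characteristic `p`, for every form `h` of degree `d < p`, the ridge ideal of the cone `h = 0` is generated by
the Hasse coefficients of `p`-power degree — which here are the LINEAR ones. This is the tree's named fact
`PrincipalRidgeIdealEqSpanHassePPow K n p` RESTRICTED to degrees `< p` (a partial discharge; the full fact needs Giraud's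
structure theorem `RidgeIdealSpanAdditive`). [folklore] -/
theorem principalRidgeIdealEqSpanHassePPow_of_lt_char (p : ℕ) [Fact p.Prime] [CharP K p] (d : ℕ)
    (h : MvPolynomial (Fin n) K) (hh : h.IsHomogeneous d) (hd : d < p) :
    ridgeIdeal (Ideal.span {h}) = Ideal.span (hasseCoefficientsPPow p d h) := by
  rw [hasseCoefficientsPPow_eq_linearHasse_of_lt (Fact.out : p.Prime).one_lt.le hd h]
  exact ridgeIdeal_span_singleton_eq_span_linearHasse_of_lt_char p hh hd

/-- [OURS · L1 W4.6 (iv)] In characteristic `0` the ridge ideal of every hypersurface cone is linear (Schober 2021,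
Rem. 2.6: «in characteristic zero … `Dir(C) = Rid(C)`»). [folklore] -/
theorem ridgeIdeal_span_singleton_eq_span_linearHasse_of_charZero [CharZero K] {h : MvPolynomial (Fin n) K} {d : ℕ}
    (hh : h.IsHomogeneous d) :
    ridgeIdeal (Ideal.span {h}) =
      Ideal.span {g | ∃ A : Fin n →₀ ℕ, A.degree + 1 = d ∧ g = hasseDeriv K A h} :=
  ridgeIdeal_span_singleton_eq_span_linearHasse hh (TamePolar.natCast_ne_zero_of_charZero d)

end Ideal

end TameRidgeIdeal
end CampaignW46
end Summit.ResolutionOfSingularities.ResolutionOfSingularities.Theorems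

end
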